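import Mathlib.MeasureTheory.Function.LpSeminorm.Basic
import Mathlib.MeasureTheory.Integral.IntervalIntegral.Basic
import Literature.Analysis.FunctionSpaces.Complexify
import Literature.Analysis.FunctionSpaces.TorusSobolevNorm
import Literature.Analysis.FunctionSpaces.TorusFluidGlue
import Literature.Analysis.FluidPDE.VectorCalculus
import Literature.Analysis.FluidPDE.WeakSolution
import HarnessLib

-- provenance: harness21/H21/H21/Prelude/FluidKinetic/LerayHopf.lean @ b28c82e (interim HEAD d8f2665); M5 mechanical rewrite
/-!
# Leray–Hopf weak solutions of the Navier–Stokes equations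

Trunk: FluidKinetic (outline `H21/Outlines/FluidKinetic.md`, item F5 `LerayHopf`; notion
`leray_hopf_solution`).

Let `E` be a finite-dimensional real inner product space (physical space, `ℝ³` in the Clay
statements) with Lebesgue measure. A **Leray–Hopf weak solution** of the forced incompressible
Navier–Stokes system on `E × [0, T)` with viscosity `ν`, force `f` and datum `u₀` (Leray 1934,
§III "solutions turbulentes"; Hopf 1951; Galdi 2000, Def. 2.1; Robinson–Rodrigo–Sadowski 2016,
Def. 3.3 and Def. 4.9) is a weak solution `u` (the accepted `Literature.Analysis.FluidPDE.IsWeakNSSolutionOn`) such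
that

* `u ∈ L^∞(0, T; L²)` and `∇u ∈ L²(0, T; L²)` — the gradient being a *weak* gradient `G t` of
  `u t` for a.e. `t` (accepted `Literature.Analysis.FluidPDE.HasWeakGradient`, i.e. G03's `HasWeakFDerivOn ⊤ volume`);
* the **energy inequality** holds from `s = 0` (with `u₀`) for every `t ∈ [0, T]`, and from a.e.
  `s ∈ (0, T)` for every `t ∈ [s, T]`:
  `½‖u(t)‖₂² + ν ∫ₛᵗ ‖∇u‖₂² ≤ ½‖u(s)‖₂² + ∫ₛᵗ ∫ ⟪f, u⟫`;
* `u` is weakly continuous into `L²` on `(0, T]` with weak limit `u₀` at `t → 0⁺`, and attains the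
  datum strongly in `L²`.

Both the weak `L²` continuity and the a.e.-`s` energy inequality are included: this is
"Leray–Hopf in the strict sense" (Galdi 2000, Def. 2.1 plus Thm. 3.1/4.6 conditions; Leray's own
solutions turbulentes satisfy them).

The torus side (namespace `Literature.Torus`) has the twin `Torus.IsLerayHopfOn` built on the accepted
`Torus.IsWeakNSSolutionForcedOn`, with dissipation measured spectrally through the accepted
`Torus.eGradNormSq` / `Torus.MemL2Sobolev` (G03).

The file also provides the mixed space–time Lebesgue norms `L^q_t L^p_x` used by the
Ladyzhenskaya–Prodi–Serrin and Escauriaza–Seregin–Šverák statements (`Fluid.eLqLpNorm`,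
`Fluid.MemLqLp`, `Fluid.ContinuousInLpOn`, torus twins `Torus.eLqLpNorm`, `Torus.MemLqLp`,
`Torus.ContinuousInLpOn` — reducible specialisations).

## Consumers note

Every Leray–Hopf-level statement measures dissipation through the weak gradient `G` (E side,
field `weakGrad_energy`) or the spectral `Torus.eGradNormSq` / `Torus.MemL2Sobolev` (torus side),
**never** through the pointwise `Fluid.gradNormSq` / `Torus.partialDeriv`, which return the junk
value `0` off differentiability.

## Mathlib search

Mathlib (this pin) has no Navier–Stokes notions and no mixed `L^q_t L^p_x` norms (searched
`Leray`, `mixedNorm`, `MixedLp`, `LqLp`: none). Used from Mathlib: `eLpNorm`, `MemLp`,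
`Filter.Tendsto`, `nhdsWithin` (`𝓝[>] 0`, `𝓝[S] t₀`), `ContinuousOn`, `intervalIntegral`,
`lintegral`, `Measure.restrict`.

## Design notes

* The mixed norms are defined for a general measure space `X` in place of `E` (it costs nothing);
  the torus twins are reducible specialisations to `X = UnitAddTorus d`.
* `Fluid.MemLqLp` is *guarded*: besides finiteness of `eLqLpNorm` it demands `u t ∈ L^p` for a.e.
  `t ∈ S`, killing the junk `(∞).toReal = 0` of the inner norm.
* The energy inequalities are stated with `Fluid.kineticEnergy` / `Torus.kineticEnergy` (Bochner,
  junk `0` off `L²`); the field `memLp : ∀ t ∈ Icc 0 T, MemLp (u t) 2` (both twins) makes every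
  slice genuinely `L²` (Galdi 2000, Def. 2.1 and Lemma 2.2: `u(t) ∈ L²` for *every* `t`), so the
  kinetic terms are never junk.
* Dissipation is spelled robustly on both sides as `(∫⁻ …).toReal` of a lower Lebesgue integral
  (E side: `(∫⁻ τ in Ioo s t, ∫⁻ x, ofReal |G τ x|²).toReal`, finite by the `L²L²` conjunct; torus
  side: `(∫⁻ τ in Ioo s t, eGradNormSq (u τ)).toReal`), so no time-measurability junk enters the
  dissipation. **Junk note:** the forcing term `∫ τ in s..t, ∫ x, ⟪f, u⟫` is a Bochner interval
  integral (junk `0` if `τ ↦ ∫ ⟪f τ, u τ⟫` is not integrable); consumers assuming `f ∈ L²L²` are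
  unaffected.
* `IsClassicalNSSolutionOn.isLerayHopfOn` carries `0 < T` and explicit integrability hypotheses
  (`u ∈ C([0,T]; L²) ∩ L³_{t,x}`, `∇u ∈ L²_{t,x}`, `p u, ⟪f, u⟫ ∈ L¹_{t,x}`) under which the
  energy *equality* of smooth solutions is a genuine theorem in every dimension.

## References

* J. Leray, *Sur le mouvement d'un liquide visqueux emplissant l'espace*, Acta Math. 63 (1934),
  §III (solutions turbulentes), (17), §§31–34.
* E. Hopf, *Über die Anfangswertaufgabe für die hydrodynamischen Grundgleichungen*, Math. Nachr.
  4 (1951), 213–231.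
* G. P. Galdi, *An introduction to the Navier–Stokes initial-boundary value problem* (2000),
  Def. 2.1, Thm. 3.1, Thm. 4.6.
* J. C. Robinson, J. L. Rodrigo, W. Sadowski, *The three-dimensional Navier–Stokes equations*
  (CUP 2016), Def. 3.3, Def. 4.9, Thm. 4.6.
* J. Serrin, *The initial value problem for the Navier–Stokes equations* (1963), §3 (mixed norms,
  energy equality under `L^q_t L^p_x` hypotheses).
-/

noncomputable section

open MeasureTheory TopologicalSpace Set Function Filter Topology
open scoped InnerProductSpace RealInnerProductSpace ENNReal NNReal

namespace Literature.Analysis.FluidPDE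

/-! ### Mixed space–time Lebesgue norms `L^q_t L^p_x` -/

section Mixed

variable {X : Type*} [MeasureSpace X]
variable {F : Type*} [NormedAddCommGroup F]

/-- The extended mixed norm `‖u‖_{L^q(S; L^p(X))} = ‖ t ↦ ‖u t‖_{L^p} ‖_{L^q(S)} ∈ [0, ∞]` of a
time-dependent field `u : ℝ → X → F` over a set of times `S` (Serrin 1963, §3; Robinson–Rodrigo–
Sadowski 2016, §1.7 and Def. 8.13, the Ladyzhenskaya–Prodi–Serrin classes `L^q(0,T; L^p)`).
**Junk note:** the inner norm enters through `ENNReal.toReal`, so times with `u t ∉ L^p`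
contribute `0`; meaningful only under the guarded predicate `MemLqLp q p u S`. [cite: Serrin1963, §3] -/
def eLqLpNorm (q p : ℝ≥0∞) (u : ℝ → X → F) (S : Set ℝ) : ℝ≥0∞ :=
  eLpNorm (fun t => (eLpNorm (u t) p volume).toReal) q (volume.restrict S)

/-- `u ∈ L^q(S; L^p(X))` (guarded): `u t ∈ L^p` for a.e. `t ∈ S` and the mixed norm
`eLqLpNorm q p u S` is finite (Serrin 1963, §3; Robinson–Rodrigo–Sadowski 2016, Def. 8.13).
Strong measurability in time of `t ↦ u t` as an `L^p`-valued map is not demanded (v0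
simplification, as for the accepted `Torus.MemL2Sobolev`). [cite: Serrin1963, §3] -/
def MemLqLp (q p : ℝ≥0∞) (u : ℝ → X → F) (S : Set ℝ) : Prop :=
  (∀ᵐ t ∂(volume.restrict S), MemLp (u t) p volume) ∧ eLqLpNorm q p u S < ∞

/-- `u ∈ C(S; L^p(X))`: for every `t ∈ S` the slice `u t` lies in `L^p`, and
`‖u t - u t₀‖_{L^p} → 0` as `t → t₀` within `S`, for every `t₀ ∈ S` (Robinson–Rodrigo–Sadowski
2016, §1.7, spaces `C([0,T]; X)`; Galdi 2000, §2). Twin of the accepted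
`Torus.ContinuousInSobolevOn`. [cite: Galdi2000, §2] -/
def ContinuousInLpOn (S : Set ℝ) (p : ℝ≥0∞) (u : ℝ → X → F) : Prop :=
  (∀ t ∈ S, MemLp (u t) p volume) ∧
    ∀ t₀ ∈ S, Tendsto (fun t => eLpNorm (u t - u t₀) p volume) (𝓝[S] t₀) (𝓝 0)

/-- Unfolding the mixed norm `L^q(S; L^p)` (Serrin 1963, §3). [cite: Serrin1963, §3] -/
theorem eLqLpNorm_def (q p : ℝ≥0∞) (u : ℝ → X → F) (S : Set ℝ) :
    eLqLpNorm q p u S = eLpNorm (fun t => (eLpNorm (u t) p volume).toReal) q (volume.restrict S) :=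
  rfl

/-- The mixed norm `L^q(S; L^p)` of the zero field vanishes (Serrin 1963, §3). [cite: Serrin1963, §3] -/
@[simp]
theorem eLqLpNorm_zero (q p : ℝ≥0∞) (S : Set ℝ) : eLqLpNorm q p (0 : ℝ → X → F) S = 0 := by
  simp [eLqLpNorm]

/-- The mixed norm is monotone in the time set (`eLpNorm_mono_measure` along
`Measure.restrict_mono`; Serrin 1963, §3). [cite: Serrin1963, §3] -/
theorem eLqLpNorm_mono_set {q p : ℝ≥0∞} {u : ℝ → X → F} {S S' : Set ℝ} (h : S' ⊆ S) :
    eLqLpNorm q p u S' ≤ eLqLpNorm q p u S :=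
  eLpNorm_mono_measure _ (Measure.restrict_mono h le_rfl)

/-- `MemLqLp` is monotone in the time set (Serrin 1963, §3). [cite: Serrin1963, §3] -/
theorem MemLqLp.mono_set {q p : ℝ≥0∞} {u : ℝ → X → F} {S S' : Set ℝ} (hu : MemLqLp q p u S)
    (h : S' ⊆ S) : MemLqLp q p u S' :=
  ⟨ae_mono (Measure.restrict_mono h le_rfl) hu.1, (eLqLpNorm_mono_set h).trans_lt hu.2⟩

/-- `ContinuousInLpOn` is monotone in the time set (Robinson–Rodrigo–Sadowski 2016, §1.7). [cite: RobinsonRodrigoSadowski2016, §1.7] -/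
theorem ContinuousInLpOn.mono {S S' : Set ℝ} {p : ℝ≥0∞} {u : ℝ → X → F}
    (hu : ContinuousInLpOn S p u) (h : S' ⊆ S) : ContinuousInLpOn S' p u :=
  ⟨fun t ht => hu.1 t (h ht), fun t₀ ht₀ => (hu.2 t₀ (h ht₀)).mono_left (nhdsWithin_mono _ h)⟩

end Mixed

/-! ### Leray–Hopf weak solutions on `E × [0, T)` -/

section LerayHopf

variable {E : Type*} [NormedAddCommGroup E] [InnerProductSpace ℝ E] [FiniteDimensional ℝ E]
  [MeasurableSpace E] [BorelSpace E]

/-- **Leray–Hopf weak solutions** of the forced incompressible Navier–Stokes system with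
viscosity `ν`, force `f` and initial datum `u₀` on `E × [0, T)` (Leray 1934, §III, "solutions
turbulentes", conditions (a)–(c) of §31–33; Hopf 1951; Galdi 2000, Def. 2.1; Robinson–Rodrigo–
Sadowski 2016, Def. 3.3 / Def. 4.9): a weak solution `u ∈ L^∞(0,T; L²) ∩ L²(0,T; Ḣ¹)` (the
gradient being a *weak* gradient `G t` of `u t` for a.e. `t`), satisfying the energy inequality
from `s = 0` and from a.e. `s ∈ (0, T)`, weakly continuous into `L²` on `(0, T]` with weak limit
`u₀` at `0⁺`, and attaining the datum strongly in `L²`. Leray–Hopf "in the strict sense": both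
the weak `L²` continuity and the a.e.-`s` energy inequality are fields. [cite: Leray1934, §III  "solutions turbulentes"  condition] -/
structure IsLerayHopfOn (T ν : ℝ) (f : ℝ → E → E) (u₀ : E → E) (u : ℝ → E → E) : Prop where
  /-- `u` is a weak (pressure-free) solution with datum `u₀` and force `f` on `[0, T)`
  (Leray 1934, (17); accepted `Fluid.IsWeakNSSolutionOn`). -/
  weak : IsWeakNSSolutionOn T ν f u₀ u
  /-- `u ∈ L^∞(0, T; L²)`: `∫ ‖u(t)‖² ≤ C` for a.e. `t ∈ (0, T)` (Leray 1934, §31 (a);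
  Galdi 2000, Def. 2.1 (i)). -/
  energy_bound : ∃ C : ℝ≥0, ∀ᵐ t ∂(volume.restrict (Ioo 0 T)), eEnergy (u t) ≤ C
  /-- Every time slice is square-integrable: `u(t) ∈ L²` for every `t ∈ [0, T]` (Galdi 2000,
  Def. 2.1 and Lemma 2.2; Leray 1934, §31). Guards the kinetic terms of the energy
  inequalities against the Bochner junk value. -/
  memLp : ∀ t ∈ Icc 0 T, MemLp (u t) 2 volume
  /-- `∇u ∈ L²(0, T; L²)` through a weak gradient `G`, and the **energy inequalities**: for every
  `t ∈ [0, T]`, `½‖u(t)‖² + ν ∫₀ᵗ ‖G‖² ≤ ½‖u₀‖² + ∫₀ᵗ ∫ ⟪f, u⟫`, and for a.e. `s ∈ (0, T)` and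
  every `t ∈ [s, T]` the same inequality from `s` (Leray 1934, §31 (b)–(c), (5.1)–(5.2);
  Galdi 2000, Def. 2.1 (ii) and (4.3); Robinson–Rodrigo–Sadowski 2016, Def. 4.9). The
  dissipation is the real part of a lower Lebesgue integral, finite by the second conjunct. -/
  weakGrad_energy : ∃ G : ℝ → E → E →L[ℝ] E,
    (∀ᵐ t ∂(volume.restrict (Ioo 0 T)), HasWeakGradient (u t) (G t)) ∧
    (∫⁻ t in Ioo 0 T, ∫⁻ x, ENNReal.ofReal (frobeniusNormSq (G t x)) < ∞) ∧
    (∀ t ∈ Icc 0 T, VectorCalculus.kineticEnergy (u t) +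
      ν * (∫⁻ τ in Ioo 0 t, ∫⁻ x, ENNReal.ofReal (frobeniusNormSq (G τ x))).toReal ≤
      VectorCalculus.kineticEnergy u₀ + ∫ τ in 0..t, ∫ x, ⟪f τ x, u τ x⟫) ∧
    (∀ᵐ s ∂(volume.restrict (Ioo 0 T)), ∀ t ∈ Icc s T, VectorCalculus.kineticEnergy (u t) +
      ν * (∫⁻ τ in Ioo s t, ∫⁻ x, ENNReal.ofReal (frobeniusNormSq (G τ x))).toReal ≤
        VectorCalculus.kineticEnergy (u s) + ∫ τ in s..t, ∫ x, ⟪f τ x, u τ x⟫)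
  /-- Weak continuity into `L²`: for every `w ∈ L²`, `t ↦ ∫ ⟪u(t), w⟫` is continuous on `(0, T]`
  and tends to `∫ ⟪u₀, w⟫` as `t → 0⁺` (Leray 1934, §31; Hopf 1951; Galdi 2000, Lemma 2.2 —
  included as a field, "strict sense"). -/
  weak_continuous : ∀ w : E → E, MemLp w 2 volume →
    ContinuousOn (fun t => ∫ x, ⟪u t x, w x⟫) (Ioc 0 T) ∧
      Tendsto (fun t => ∫ x, ⟪u t x, w x⟫) (𝓝[>] 0) (𝓝 (∫ x, ⟪u₀ x, w x⟫))
  /-- The datum is attained strongly in `L²`: `‖u(t) - u₀‖₂ → 0` as `t → 0⁺` (Leray 1934, §31 (c);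
  Galdi 2000, Def. 2.1 (iv)). -/
  strong_initial : Tendsto (fun t => eLpNorm (u t - u₀) 2 volume) (𝓝[>] 0) (𝓝 0)

/-- **Global Leray–Hopf weak solutions** on `E × [0, ∞)`: Leray–Hopf on `[0, T)` for every
`T > 0` (Leray 1934, §III, Thm. of §34: existence for every `u₀ ∈ L²`; Hopf 1951). [cite: Leray1934, §III  Thm. of §34: existence for every] -/
def IsGlobalLerayHopf (ν : ℝ) (f : ℝ → E → E) (u₀ : E → E) (u : ℝ → E → E) : Prop :=
  ∀ T : ℝ, 0 < T → IsLerayHopfOn T ν f u₀ u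

variable {T T' ν : ℝ} {f u : ℝ → E → E} {u₀ : E → E} {p : ℝ → E → ℝ}

/-- A Leray–Hopf solution is in particular a weak solution (projection). [folklore] -/
theorem IsLerayHopfOn.isWeakNSSolutionOn (h : IsLerayHopfOn T ν f u₀ u) :
    IsWeakNSSolutionOn T ν f u₀ u :=
  h.weak

/-- **The energy inequality from `s = 0`** of a Leray–Hopf solution: there is a weak gradient
`G` of `u` (a.e. in time) with `½‖u(t)‖² + ν ∫₀ᵗ ∫ |G|² ≤ ½‖u₀‖² + ∫₀ᵗ ∫ ⟪f, u⟫` for all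
`t ∈ [0, T]` (Leray 1934, (5.2); Galdi 2000, Def. 2.1 (ii)). Projection of the field
`weakGrad_energy`. [cite: Leray1934, (5.2] -/
theorem IsLerayHopfOn.energy_ineq_zero (h : IsLerayHopfOn T ν f u₀ u) :
    ∃ G : ℝ → E → E →L[ℝ] E,
      (∀ᵐ t ∂(volume.restrict (Ioo 0 T)), HasWeakGradient (u t) (G t)) ∧
      ∀ t ∈ Icc 0 T, VectorCalculus.kineticEnergy (u t) +
        ν * (∫⁻ τ in Ioo 0 t, ∫⁻ x, ENNReal.ofReal (frobeniusNormSq (G τ x))).toReal ≤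
        VectorCalculus.kineticEnergy u₀ + ∫ τ in 0..t, ∫ x, ⟪f τ x, u τ x⟫ := by
  obtain ⟨G, hG, -, h0, -⟩ := h.weakGrad_energy
  exact ⟨G, hG, h0⟩

/-- Every slice of a Leray–Hopf solution has finite energy, and `kineticEnergy (u t)` is the
honest `½‖u(t)‖₂²`: `∫⁻ ‖u t‖ₑ² = ofReal (2 · kineticEnergy (u t))` for every `t ∈ [0, T]`
(Galdi 2000, Lemma 2.2; accepted `eEnergy_eq_ofReal`). [cite: Galdi2000, Lemma 2.2] -/
theorem IsLerayHopfOn.eEnergy_eq (h : IsLerayHopfOn T ν f u₀ u) {t : ℝ} (ht : t ∈ Icc 0 T) :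
    eEnergy (u t) = ENNReal.ofReal (2 * VectorCalculus.kineticEnergy (u t)) :=
  eEnergy_eq_ofReal _ (h.memLp t ht)

/-- A global Leray–Hopf solution is Leray–Hopf on every `[0, T)`, `T > 0` (definitional). [folklore] -/
theorem IsGlobalLerayHopf.isLerayHopfOn (h : IsGlobalLerayHopf ν f u₀ u) (hT : 0 < T) :
    IsLerayHopfOn T ν f u₀ u :=
  h T hT

/-- **Restriction in time.** A Leray–Hopf solution on `[0, T)` is one on `[0, T')` for every
`T' ≤ T`: the weak formulation restricts (`IsWeakNSSolutionOn.mono`), the bounds and energy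
inequalities restrict along `Ioo 0 T' ⊆ Ioo 0 T`, `Icc s T' ⊆ Icc s T`, and weak continuity
restricts to `Ioc 0 T'` (Leray 1934, §III). [cite: Leray1934, §III] -/
def IsLerayHopfOn.mono : Prop :=
  ∀ (h : IsLerayHopfOn T ν f u₀ u) (hT : T' ≤ T),
    IsLerayHopfOn T' ν f u₀ u

/-- **Smooth finite-energy solutions are Leray–Hopf solutions** (with energy *equality*). Let
`(u, p)` be a classical solution on a time set `S ⊇ [0, T]`, `T > 0`, with `u ∈ C([0,T]; L²)`,
`∇u ∈ L²((0,T) × E)`, `u ∈ L³((0,T) × E)`, and `p u`, `⟪f, u⟫ ∈ L¹((0,T) × E)`. Then `u` is a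
Leray–Hopf weak solution on `[0, T)` with datum `u 0`: multiply the momentum equation by
`u φ_R` for a cut-off `φ_R`, integrate by parts and let `R → ∞` — the flux terms
`∫ (½|u|² + p) u · ∇φ_R` and `ν ∫ ½|u|² Δφ_R` vanish in the limit by the integrability hypotheses,
giving the energy equality on every `[s, t] ⊆ [0, T]`; the classical gradient is a weak gradient
(`HasWeakGradient.of_contDiff`); weak and strong `L²` continuity follow from `u ∈ C([0,T]; L²)`
(for `T > 0`, `𝓝[>] 0 ≤ 𝓝[Icc 0 T] 0`; the hypothesis `0 < T` is necessary, the conclusion's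
`𝓝[>] 0`-limits being unrestricted by `T`)
(Leray 1934, §III §§15–17 (energy equality for regular solutions); Serrin 1963, §3;
Galdi 2000, Thm. 4.1; Robinson–Rodrigo–Sadowski 2016, Thm. 4.6). [cite: Leray1934, §III §§15–17 (energy equality for regula] -/
def IsClassicalNSSolutionOn.isLerayHopfOn : Prop :=
  ∀ {S : Set ℝ} (h : IsClassicalNSSolutionOn S ν f u p) (hT : 0 < T) (hS : Icc 0 T ⊆ S) (hu₂ : ContinuousInLpOn (Icc 0 T) 2 u) (hgrad : ∫⁻ t in Ioo 0 T, ∫⁻ x, ENNReal.ofReal (frobeniusNormSq (fderiv ℝ (u t) x)) < ∞) (hu₃ : ∫⁻ t in Ioo 0 T, ∫⁻ x, ‖u t x‖ₑ ^ (3 : ℕ) < ∞) (hp : ∫⁻ t in Ioo 0 T, ∫⁻ x, ‖p t x‖ₑ * ‖u t x‖ₑ < ∞) (hf : ∫⁻ t in Ioo 0 T, ∫⁻ x, ‖f t x‖ₑ * ‖u t x‖ₑ < ∞),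
    IsLerayHopfOn T ν f (u 0) u

end LerayHopf

end Literature.Analysis.FluidPDE

/-! ### Torus side: Leray–Hopf solutions on `T^d × [0, T)` and mixed norms -/

namespace Literature.Analysis.FluidPDE.Torus

variable {d : Type*} [Fintype d] [DecidableEq d]

section Mixed

variable {F : Type*} [NormedAddCommGroup F]

omit [DecidableEq d] in
/-- The extended mixed norm `‖u‖_{L^q(S; L^p(T^d))}` of a time-dependent field on the flat unit
torus: the specialisation of `Literature.Analysis.FluidPDE.eLqLpNorm` to `X = UnitAddTorus d` (Serrin 1963, §3;
Robinson–Rodrigo–Sadowski 2016, Def. 8.13). Same junk note (inner `toReal`). [cite: Serrin1963, §3] -/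
abbrev eLqLpNorm (q p : ℝ≥0∞) (u : ℝ → UnitAddTorus d → F) (S : Set ℝ) : ℝ≥0∞ :=
  FluidPDE.eLqLpNorm q p u S

omit [DecidableEq d] in
/-- `u ∈ L^q(S; L^p(T^d))` (guarded) on the flat unit torus: the specialisation of
`Literature.Analysis.FluidPDE.MemLqLp` (Serrin 1963, §3; Robinson–Rodrigo–Sadowski 2016, Def. 8.13). [cite: Serrin1963, §3] -/
abbrev MemLqLp (q p : ℝ≥0∞) (u : ℝ → UnitAddTorus d → F) (S : Set ℝ) : Prop :=
  FluidPDE.MemLqLp q p u S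

omit [DecidableEq d] in
/-- `u ∈ C(S; L^p(T^d))` on the flat unit torus: the specialisation of
`Literature.Analysis.FluidPDE.ContinuousInLpOn` (Robinson–Rodrigo–Sadowski 2016, §1.7; twin of the accepted
`Torus.ContinuousInSobolevOn`). [cite: RobinsonRodrigoSadowski2016, §1.7] -/
abbrev ContinuousInLpOn (S : Set ℝ) (p : ℝ≥0∞) (u : ℝ → UnitAddTorus d → F) : Prop :=
  FluidPDE.ContinuousInLpOn S p u

end Mixed

/-- **Leray–Hopf weak solutions on the flat torus** `T^d × [0, T)` with viscosity `ν`, force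
`f` and datum `u₀` (Leray 1934, §III; Hopf 1951; Galdi 2000, Def. 2.1; Robinson–Rodrigo–
Sadowski 2016, Def. 3.3 / Def. 4.9 on `𝕋³`; Temam, Ch. III, Thm. 3.1): a forced weak solution
(accepted `Torus.IsWeakNSSolutionForcedOn`) in `L^∞(0,T; L²) ∩ L²(0,T; H¹)` — the latter
spectrally, via the accepted `Torus.MemL2Sobolev 0 T 1` of the complexified field — satisfying
the energy inequalities from `s = 0` and from a.e. `s ∈ (0, T)` with dissipation
`ν ∫ₛᵗ ‖∇u‖₂²` measured by the spectral `Torus.eGradNormSq`, weakly continuous into `L²` on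
`(0, T]` with weak limit `u₀` at `0⁺`, and attaining the datum strongly in `L²`. Twin of
`Literature.Analysis.FluidPDE.IsLerayHopfOn` (parallel fields, same order; the E-side `weakGrad_energy` splits into
`memL2Sobolev` / `energy_ineq_zero` / `energy_ineq_ae` since no gradient witness is needed). [cite: Leray1934, §III] -/
structure IsLerayHopfOn (T ν : ℝ) (f : ℝ → UnitAddTorus d → EuclideanSpace ℝ d)
    (u₀ : UnitAddTorus d → EuclideanSpace ℝ d) (u : ℝ → UnitAddTorus d → EuclideanSpace ℝ d) :
    Prop where
  /-- `u` is a forced weak (pressure-free) solution with datum `u₀` on `[0, T)`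
  (accepted `Torus.IsWeakNSSolutionForcedOn`). -/
  weak : IsWeakNSSolutionForcedOn T ν f u₀ u
  /-- `u ∈ L^∞(0, T; L²)`: `∫ ‖u(t)‖² ≤ C` for a.e. `t ∈ (0, T)` (Galdi 2000, Def. 2.1 (i)). -/
  energy_bound : ∃ C : ℝ≥0, ∀ᵐ t ∂(volume.restrict (Ioo 0 T)), ∫⁻ x, ‖u t x‖ₑ ^ 2 ≤ C
  /-- Every time slice is square-integrable: `u(t) ∈ L²(T^d)` for every `t ∈ [0, T]` (Galdi
  2000, Def. 2.1 and Lemma 2.2). Guards the kinetic terms of the energy inequalities. -/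
  memLp : ∀ t ∈ Icc 0 T, MemLp (u t) 2 volume
  /-- `u ∈ L²(0, T; H¹(T^d))`, spectrally (accepted `Torus.MemL2Sobolev`, complexified field)
  (Temam, Ch. III, Thm. 3.1; Galdi 2000, Def. 2.1 (i)). -/
  memL2Sobolev : FunctionSpaces.Torus.MemL2Sobolev 0 T 1 (fun t => FunctionSpaces.EuclideanSpace.complexify ∘ u t)
  /-- **Energy inequality from `0`**: for every `t ∈ [0, T]`,
  `½‖u(t)‖² + ν ∫₀ᵗ ‖∇u‖₂² ≤ ½‖u₀‖² + ∫₀ᵗ ∫ ⟪f, u⟫` (Leray 1934, (5.2); Galdi 2000,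
  Def. 2.1 (ii)). -/
  energy_ineq_zero : ∀ t ∈ Icc 0 T,
    FunctionSpaces.Torus.kineticEnergy (u t) + ν * (∫⁻ τ in Ioo 0 t, FunctionSpaces.Torus.eGradNormSq (u τ)).toReal ≤
      FunctionSpaces.Torus.kineticEnergy u₀ + ∫ τ in 0..t, ∫ x, ⟪f τ x, u τ x⟫
  /-- **Energy inequality from a.e. `s`**: for a.e. `s ∈ (0, T)` and every `t ∈ [s, T]`,
  `½‖u(t)‖² + ν ∫ₛᵗ ‖∇u‖₂² ≤ ½‖u(s)‖² + ∫ₛᵗ ∫ ⟪f, u⟫` (Leray 1934, (5.1); Galdi 2000, (4.3);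
  Robinson–Rodrigo–Sadowski 2016, Def. 4.9). -/
  energy_ineq_ae : ∀ᵐ s ∂(volume.restrict (Ioo 0 T)), ∀ t ∈ Icc s T,
    FunctionSpaces.Torus.kineticEnergy (u t) + ν * (∫⁻ τ in Ioo s t, FunctionSpaces.Torus.eGradNormSq (u τ)).toReal ≤
      FunctionSpaces.Torus.kineticEnergy (u s) + ∫ τ in s..t, ∫ x, ⟪f τ x, u τ x⟫
  /-- Weak continuity into `L²` on `(0, T]` with weak limit `u₀` at `0⁺` (Galdi 2000,
  Lemma 2.2; Hopf 1951). -/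
  weak_continuous : ∀ w : UnitAddTorus d → EuclideanSpace ℝ d, MemLp w 2 volume →
    ContinuousOn (fun t => ∫ x, ⟪u t x, w x⟫) (Ioc 0 T) ∧
      Tendsto (fun t => ∫ x, ⟪u t x, w x⟫) (𝓝[>] 0) (𝓝 (∫ x, ⟪u₀ x, w x⟫))
  /-- The datum is attained strongly in `L²`: `‖u(t) - u₀‖₂ → 0` as `t → 0⁺` (Galdi 2000,
  Def. 2.1 (iv)). -/
  strong_initial : Tendsto (fun t => eLpNorm (u t - u₀) 2 volume) (𝓝[>] 0) (𝓝 0)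

/-- **Global Leray–Hopf weak solutions on the flat torus** `T^d × [0, ∞)`: Leray–Hopf on
`[0, T)` for every `T > 0` (Hopf 1951; Temam, Ch. III, Thm. 3.1). [cite: Hopf1951] -/
def IsGlobalLerayHopf (ν : ℝ) (f : ℝ → UnitAddTorus d → EuclideanSpace ℝ d)
    (u₀ : UnitAddTorus d → EuclideanSpace ℝ d) (u : ℝ → UnitAddTorus d → EuclideanSpace ℝ d) :
    Prop :=
  ∀ T : ℝ, 0 < T → IsLerayHopfOn T ν f u₀ u

variable {T T' ν : ℝ} {f u : ℝ → UnitAddTorus d → EuclideanSpace ℝ d}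
  {u₀ : UnitAddTorus d → EuclideanSpace ℝ d}

/-- A Leray–Hopf solution on the torus is in particular a forced weak solution with datum
(projection of the field `weak`). [folklore] -/
theorem IsLerayHopfOn.isWeakNSSolutionForcedOn (h : IsLerayHopfOn T ν f u₀ u) :
    IsWeakNSSolutionForcedOn T ν f u₀ u :=
  h.weak

/-- A Leray–Hopf solution on the torus lies in `L²(0, T; H¹)` (spectral; projection of the field
`memL2Sobolev`; Temam, Ch. III, Thm. 3.1). [folklore] -/
theorem IsLerayHopfOn.memL2Sobolev_one (h : IsLerayHopfOn T ν f u₀ u) :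
    FunctionSpaces.Torus.MemL2Sobolev 0 T 1 (fun t => FunctionSpaces.EuclideanSpace.complexify ∘ u t) :=
  h.memL2Sobolev

/-- An unforced Leray–Hopf solution on the torus is a weak solution with datum in the accepted
G03 sense (`isWeakNSSolutionForcedOn_zero_iff`). [folklore] -/
theorem IsLerayHopfOn.isWeakNSSolutionWithDataOn (h : IsLerayHopfOn T ν 0 u₀ u) :
    FunctionSpaces.Torus.IsWeakNSSolutionWithDataOn T ν u₀ u :=
  isWeakNSSolutionForcedOn_zero_iff.1 h.weak

/-- A global Leray–Hopf solution on the torus is Leray–Hopf on every `[0, T)`, `T > 0`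
(definitional). [folklore] -/
theorem IsGlobalLerayHopf.isLerayHopfOn (h : IsGlobalLerayHopf ν f u₀ u) (hT : 0 < T) :
    IsLerayHopfOn T ν f u₀ u :=
  h T hT

/-- **Restriction in time** on the torus: a Leray–Hopf solution on `[0, T)` is one on `[0, T')`
for every `T' ≤ T` (twin of `Fluid.IsLerayHopfOn.mono`; Leray 1934, §III). [cite: Leray1934, §III] -/
def IsLerayHopfOn.mono : Prop :=
  ∀ (h : IsLerayHopfOn T ν f u₀ u) (hT : T' ≤ T),
    IsLerayHopfOn T' ν f u₀ u

end Literature.Analysis.FluidPDE.Torus
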